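import Summits.BirchSwinnertonDyer.BirchSwinnertonDyer.Theorems.PrintCf2RubinValueTwoLinePushUnramifiedDatum
import Summits.BirchSwinnertonDyer.BirchSwinnertonDyer.Theorems.PrintCf2SplitBadTwoTowerOverSplitLines
import Summits.BirchSwinnertonDyer.BirchSwinnertonDyer.Theorems.EisensteinPrimesTwoVariableSelmerControl
import HarnessLib

/-!
# Route C `PrintCf2RubinValueTwo`, crux `RestrictedMainConjWithValueAtTwo` (stmt-BirchSwinnertonDyer-23722) / road α skeleton v12, brick (RES) —
# exact control for the UNRAMIFIED (Greenberg–Vatsal) datum over the line for ANY PARTNER `κ₁` of the `v̄`-line `κ₂`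
# (the hypothesis `κ₁.IsUnramifiedOutside v` of p685748 `LinePush.charIdeal_quotSMulTop_eq_unr_of_frame` dropped)

Cell `bsd-print-cf2`, width seat `bsd-line-cf2c-w2` g2 (prover-bsd-line-cf2c-w2-g2-0); `--supports stmt-BirchSwinnertonDyer-23722` (route-C twin of the
LEAD's S3b′-v12 `stub_restrictedMainConj_two_v12`, whose frame block binds a generator pair `(κ₁, κ₂; γ₁, γ₂)` with `κ₂.IsUnramifiedOutside vbar` and NO
condition on `κ₁`). Sequel of cf2c-w8 g0's p685748 (`…LinePushUnramifiedDatum`); answers LEAD cf2-p1 g13's ruling line of 2026-08-29T01:35:23Z («one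
wrinkle: it assumes `κ₁.IsUnramifiedOutside v` — please drop it via -w5 g4 p680726»). HONEST FRAMING: nothing here closes the crux or the registered
stub; BSD is not proved by any of this; no summit statement is proved by this seat. No definition, no named fact, no `sorry`.

WHY `κ₁.IsUnramifiedOutside v` IS IDLE. In p685748 it is used twice: (a) in `comap_resOfLe_unrSelmer₂_eq_unrSelmer` to get `ker κ₂ ⊓ I_w ≤ pairKer κ₁ κ₂`
at the places `w ∤ p` and `w = v̄` where the datum `bdpData M p v̄` imposes a condition; (b) in `finite_fixedPoints_pairKer_of_frame_right` (`W*(K̃_∞)`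
finite) to put the inertia group of the additive place `w ∣ 7` inside `pairKer κ₁ κ₂`. But at `w ∤ p` EVERY `ℤ_p`-extension is unramified
(`IwasawaTwoVariable.inertia_le_kerSubgroup_of_not_mem`, Washington Prop. 13.2 — a tree theorem), which settles (b) and the `w ∤ p` half of (a) for
ANY `κ₁`; and above `v̄` inertia is RANK ONE in the `ℤ_p²`-tower of an imaginary quadratic field at a split prime, so `I_𝔓 ⊓ ker κ₂ ≤ pairKer κ₁ κ₂`
for THE line `κ₂` unramified outside `v̄` and ANY partner `κ₁` (-w5 g4 p680726 `SplitPrimeLine.inertia_inf_kerSubgroup_le_pairKer_of_isUnramifiedOutside`).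
* §1 (generic `K`, `p`, elliptic `E/K`): **`finite_fixedPoints_pairKer_geomPrimaryTorsion_of_hasAdditiveReductionAt_of_not_mem`** and its CM-summand
  form — `E[p^∞]^{Gal(K̄/K̃_∞)}` is finite for ANY two `ℤ_p`-lines `κ₁, κ₂` as soon as `E` is additive at some `w ∤ p`; road α:
  **`finite_fixedPoints_pairKer_of_frame_any`** — `W*(K̃_∞)` finite for ANY `κ₁ κ₂ : ZpExtension K 2` (no `v`, `v̄` in the statement).
* §2 (generic `K`, `p`, `M`): **`comap_resOfLe_unrSelmer₂_eq_unrSelmer_of_inf_inertia_le`** and **`exists_linearMap_quotSMulTop_unr_of_inf_inertia_le`**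
  — p685748 §1–§2 with the SINGLE hypothesis `hI : κ₂.kerSubgroup ⊓ inertia v̄ ≤ κ₁.kerSubgroup` in place of
  `κ₁.IsUnramifiedOutside v ∧ κ₂.IsUnramifiedOutside v̄ ∧ v̄ ≠ v ∧ p ∈ v` (proofs verbatim otherwise).
* §3 (road α frames, `p = 2`, `K` imaginary quadratic, `2 = v v̄`): **`kerSubgroup_inf_inertia_le_of_isUnramifiedOutside_of_pair`** discharges `hI`
  for every generator pair whose second slot is unramified outside `v̄`; **`charIdeal_quotSMulTop_eq_unr_of_frame_anyPartner`** — p685748 §3 with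
  `hκ₁` DELETED: `ArePseudoIsomorphic Λ (QuotSMulTop T₁ D₂.X) D_nr.X` and `ch_Λ(D₂.X ⧸ T₁ D₂.X) = ch_Λ(D_nr.X)` for ANY partner `κ₁`.
presearch: Greenberg–Vatsal 2000 §2; Greenberg LNM 1716 §1 p. 53 («`F̃/F_∞` unramified when `p` splits»), §3; Washington Prop. 13.2; Agboola 2007
§3 Prop. 3.2 — all held / in tree; assembly of tree theorems, no new fact. beyond-print theorem: no.

References: [GreenbergVatsal2000] §2 pp. 17–21; [GreenbergLNM1716] §1 p. 53, §3 Lemmas 3.1–3.2; [Washington1997] Prop. 13.2, Thm. 13.4;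
[Agboola2007] §3 Prop. 3.2, §4; [SilvermanATAEC1994] Thm. IV.10.2(a).
-/

noncomputable section

open scoped Classical Pointwise
-- the summit namespace `Summit.BirchSwinnertonDyer.BirchSwinnertonDyer` repeats the problem name by design (D-0017)
set_option linter.dupNamespace false
set_option autoImplicit false

open NumberField IsDedekindDomain Field WeierstrassCurve
open Literature.NumberTheory.EllipticCurves Literature.NumberTheory.EllipticCurves.GreenbergSelmer
open Literature.NumberTheory.EllipticCurves.GreenbergVatsal2000 Literature.NumberTheory.EllipticCurves.KellerYin2024
open Literature.NumberTheory.EllipticCurves.Agboola2007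
open Literature.NumberTheory.EllipticCurves.IwasawaDual
open Literature.NumberTheory.GaloisRepresentations
open Summit.BirchSwinnertonDyer.BirchSwinnertonDyer.Theorems.IwasawaTwoVariable
open Summit.BirchSwinnertonDyer.BirchSwinnertonDyer.Theorems.PrintCf2.RestrictedSelmerPair

universe u

namespace Summit.BirchSwinnertonDyer.BirchSwinnertonDyer.Theorems.PrintCf2.LinePush

/-! ## §1. `E[p^∞]^{Gal(K̄/K̃_∞)}` is finite for ANY pair of lines when `E` is additive at some `w ∤ p` -/

section GenericFinite

variable {K : Type u} [Field K] [NumberField K] {p : ℕ} [Fact p.Prime]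

/-- **Inertia at `w ∤ p` lies in `Gal(K̄/K̃_∞)` for ANY two `ℤ_p`-lines**: every local inertia element at `w` (through `res : Γ_{K_w} → Γ_K`)
lies in `ker κ₁ ⊓ ker κ₂ = pairKer κ₁ κ₂` (`I_w ≤ ker κ` for every `ℤ_p`-extension `κ` and every `w ∤ p`, Washington Prop. 13.2, tree theorem
`IwasawaTwoVariable.inertia_le_kerSubgroup_of_not_mem`) and hence fixes every `m ∈ M^{Gal(K̄/K̃_∞)}`. The hypothesis-free twin of p683924's
`smul_eq_self_of_mem_absInertia_of_isUnramifiedOutside_pair`. [cite: Washington1997, Prop. 13.2] -/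
theorem smul_eq_self_of_mem_absInertia_of_not_mem (κ₁ κ₂ : ZpExtension K p) {w : HeightOneSpectrum (𝓞 K)}
    (hwp : ((p : ℕ) : 𝓞 K) ∉ w.asIdeal) {M : Type u} [AddCommGroup M] [DistribMulAction (absoluteGaloisGroup K) M]
    {m : M} (hm : m ∈ FixedPoints.addSubgroup (ZpExtension.pairKer κ₁ κ₂) M)
    {σ : absoluteGaloisGroup (w.adicCompletion K)} (hσ : σ ∈ absInertia (w.adicCompletion K)) :
    absGaloisRestrict K (w.adicCompletion K) σ • m = m := by
  have hI : absGaloisRestrict K (w.adicCompletion K) σ ∈ inertia w := Subgroup.mem_map.mpr ⟨σ, hσ, rfl⟩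
  have hmem : absGaloisRestrict K (w.adicCompletion K) σ ∈ ZpExtension.pairKer κ₁ κ₂ :=
    Subgroup.mem_inf.mpr ⟨inertia_le_kerSubgroup_of_not_mem κ₁ hwp hI, inertia_le_kerSubgroup_of_not_mem κ₂ hwp hI⟩
  exact hm ⟨_, hmem⟩

/-- **`E[p^∞]^{Gal(K̄/K̃_∞)}` is finite for ANY two `ℤ_p`-lines `κ₁, κ₂`** when `E/K` has ADDITIVE reduction at a finite place `w ∤ p`: `I_w ≤ pairKer κ₁ κ₂`
(§1) and the `I_w`-fixed `p`-power torsion is killed by one `c ≠ 0` (Silverman *ATAEC* IV.10.2(a), additive case), so `E[p^∞]^{Gal(K̄/K̃_∞)} ↪ E[c]`.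
p683924's `finite_fixedPoints_pairKer_geomPrimaryTorsion_of_hasAdditiveReductionAt` with its two `IsUnramifiedOutside` hypotheses DELETED.
[cite: SilvermanATAEC1994, Thm. IV.10.2(a)] [cite: Washington1997, Prop. 13.2] -/
theorem finite_fixedPoints_pairKer_geomPrimaryTorsion_of_hasAdditiveReductionAt_of_not_mem
    (W : WeierstrassCurve K) [W.IsElliptic] (κ₁ κ₂ : ZpExtension K p) {w : HeightOneSpectrum (𝓞 K)}
    (hwp : ((p : ℕ) : 𝓞 K) ∉ w.asIdeal) (hadd : W.HasAdditiveReductionAt w) :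
    Finite (FixedPoints.addSubgroup (ZpExtension.pairKer κ₁ κ₂) (W.geomPrimaryTorsion p)) := by
  obtain ⟨c, hc, hkill⟩ := W.exists_nsmul_eq_zero_of_absInertia_fixed_of_hasAdditiveReductionAt p hwp hadd
  haveI : Finite (geomTorsion W (c : ℤ)) := W.finite_geomTorsion_natCast hc
  let f : FixedPoints.addSubgroup (ZpExtension.pairKer κ₁ κ₂) (W.geomPrimaryTorsion p) → geomTorsion W (c : ℤ) :=
    fun x ↦ ⟨((x : W.geomPrimaryTorsion p) : geomPoints W), by
      rw [W.mem_geomTorsion_iff, natCast_zsmul]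
      obtain ⟨n, hn⟩ := (AddCommGroup.mem_primaryComponent).mp (x : W.geomPrimaryTorsion p).2
      refine hkill _ (fun σ hσ ↦ ?_) n hn
      have h := smul_eq_self_of_mem_absInertia_of_not_mem κ₁ κ₂ hwp x.2 hσ
      have h' := congrArg (fun y : W.geomPrimaryTorsion p ↦ (y : geomPoints W)) h
      simpa only [primaryComponent.coe_smul] using h'⟩
  have hf : Function.Injective f := fun a b hab ↦ by
    have h1 := congrArg Subtype.val hab
    exact Subtype.ext (Subtype.ext h1)
  exact Finite.of_injective f hf

/-- **The CM-summand form, ANY pair of lines**: for ANY `K`-rational endomorphism `π` and `r ∈ ℤ_p`, `(↥(W.endEigenPrimaryTorsion p π r))^{Gal(K̄/K̃_∞)}` is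
finite when `W` is additive at some `w ∤ p` (it embeds into `E[p^∞]^{Gal(K̄/K̃_∞)}`). [cite: Agboola2007, §3 Prop. 3.2 (`W*(K*_∞)`)]
[cite: SilvermanATAEC1994, Thm. IV.10.2(a)] -/
theorem finite_fixedPoints_pairKer_endEigenPrimaryTorsion_of_hasAdditiveReductionAt_of_not_mem
    (W : WeierstrassCurve K) [W.IsElliptic] (π : W.endRing) (r : ℤ_[p]) (κ₁ κ₂ : ZpExtension K p)
    {w : HeightOneSpectrum (𝓞 K)} (hwp : ((p : ℕ) : 𝓞 K) ∉ w.asIdeal) (hadd : W.HasAdditiveReductionAt w) :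
    Finite (FixedPoints.addSubgroup (ZpExtension.pairKer κ₁ κ₂) ↥(W.endEigenPrimaryTorsion p π r)) := by
  haveI := finite_fixedPoints_pairKer_geomPrimaryTorsion_of_hasAdditiveReductionAt_of_not_mem W κ₁ κ₂ hwp hadd
  let f : FixedPoints.addSubgroup (ZpExtension.pairKer κ₁ κ₂) ↥(W.endEigenPrimaryTorsion p π r) →
      FixedPoints.addSubgroup (ZpExtension.pairKer κ₁ κ₂) (W.geomPrimaryTorsion p) :=
    fun x ↦ ⟨((x : ↥(W.endEigenPrimaryTorsion p π r)) : W.geomPrimaryTorsion p), fun τ ↦ by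
      have h := x.2 τ
      exact congrArg Subtype.val h⟩
  have hf : Function.Injective f := fun a b hab ↦ by
    have h1 := congrArg Subtype.val hab
    exact Subtype.ext (Subtype.ext h1)
  exact Finite.of_injective f hf

end GenericFinite

/-! ## §2. `J = H¹_nr(K_∞^{(2)}, M)` and exact control, under the single hypothesis `ker κ₂ ⊓ I_v̄ ≤ ker κ₁` -/

section Line

variable {K : Type u} [Field K] [NumberField K] {p : ℕ} [Fact p.Prime] {κ₁ κ₂ : ZpExtension K p}
  {M : Type u} [AddCommGroup M] [DistribMulAction (absoluteGaloisGroup K) M] [TopologicalSpace M] [DiscreteTopology M]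
  {vbar : HeightOneSpectrum (𝓞 K)}

/-- **`J = H¹_nr(K_∞^{(2)}, M)` under `ker κ₂ ⊓ I_v̄ ≤ ker κ₁` alone**: a class over the line `K_∞^{(2)} = K̄^{ker κ₂}` restricts into
`unrSelmer₂ κ₁ κ₂ M v̄ = H¹_nr(K̃_∞, M)` IFF it lies in `unrSelmer κ₂ M v̄ ∅ = H¹_nr(K_∞^{(2)}, M)`: `⇐` bsd-eis `resOfLe_mem_datumSelmer`; `⇒` p685748's
`mem_datumSelmer_bdpData_of_resOfLe_mem` with `ker κ₂ ⊓ I_w ≤ pairKer κ₁ κ₂` at `w ∤ p` (AUTOMATIC: `I_w ≤ ker κ₁`, Washington 13.2) and at `w = v̄` (the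
hypothesis). p685748's `comap_resOfLe_unrSelmer₂_eq_unrSelmer` is the case `hI := fun x hx ↦ hκ₁ v̄ hne hx.2`.
[cite: GreenbergVatsal2000, §2 pp. 17, 20] [cite: Washington1997, Prop. 13.2] -/
theorem comap_resOfLe_unrSelmer₂_eq_unrSelmer_of_inf_inertia_le (hI : κ₂.kerSubgroup ⊓ inertia vbar ≤ κ₁.kerSubgroup) :
    (unrSelmer₂ κ₁ κ₂ M vbar).comap (resOfLe M (ZpExtension.pairKer_le_right κ₁ κ₂)) = unrSelmer κ₂ M vbar ∅ := by
  have hI' : ∀ w : HeightOneSpectrum (𝓞 K), ((p : ℕ) : 𝓞 K) ∉ w.asIdeal ∨ w = vbar →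
      κ₂.kerSubgroup ⊓ inertia w ≤ ZpExtension.pairKer κ₁ κ₂ := by
    intro w hw x hx
    rcases hw with hw | rfl
    · exact Subgroup.mem_inf.mpr ⟨inertia_le_kerSubgroup_of_not_mem κ₁ hw hx.2, hx.1⟩
    · exact Subgroup.mem_inf.mpr ⟨hI hx, hx.1⟩
  ext c
  rw [AddSubgroup.mem_comap]
  constructor
  · intro hc
    exact mem_datumSelmer_bdpData_of_resOfLe_mem (ZpExtension.pairKer_le_right κ₁ κ₂) hI' hc
  · intro hc
    exact resOfLe_mem_datumSelmer p (Castella2018.AcSelmer.bdpData M p vbar) ∅ (ZpExtension.pairKer_le_right κ₁ κ₂) hc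

variable {γ₁ γ₂ : absoluteGaloisGroup K}

/-- **(RES) FOR THE GREENBERG–VATSAL DATUM, ANY PARTNER: the `Λ`-linear control map `QuotSMulTop T₁ D₂.X →ₗ[Λ] D_nr.X` is INJECTIVE with FINITE
COKERNEL.** For a generator pair `(κ₁, κ₂; γ₁, γ₂)` with `ker κ₂ ⊓ I_v̄ ≤ ker κ₁` (e.g. `κ₂` THE line unramified outside `v̄` of an imaginary quadratic
`K` with `p = v v̄`, §3 — or `κ₁` unramified outside `v ≠ v̄`, p685748), a discrete `p`-primary `M` with open stabilisers and continuous orbits and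
`M^{Gal(K̄/K̃_∞)} ⧸ (γ₁ − 1)` finite, ANY `D₂ : DualData₂ κ₁ κ₂ M v̄ γ₁ γ₂` and ANY `D_nr : DatumDualData κ₂ γ₂ M (bdpData M p v̄) ∅`: there is a
`Λ`-linear `f` (compHom along `PowerSeries.C`), `D_nr.toDual (f [x]) t = D₂.toDual x (res t)`, INJECTIVE (exact control: tower lift p684615 +
`comap_resOfLe_unrSelmer₂_eq_unrSelmer_of_inf_inertia_le`) with cokernel finite, `# ≤ #(M^{pairKer} ⧸ (γ₁ − 1))`. Proof = p685748 §2 verbatim with the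
one call to `comap_resOfLe_unrSelmer₂_eq_unrSelmer` replaced. [cite: GreenbergVatsal2000, §2 pp. 17–21] [cite: SkinnerUrban2014, Prop. 3.2.8 (p. 23)]
[cite: GreenbergLNM1716, §3 Lemmas 3.1–3.2] -/
theorem exists_linearMap_quotSMulTop_unr_of_inf_inertia_le (hγ : ZpExtension.IsTopGeneratorPair κ₁ κ₂ γ₁ γ₂)
    (hI : κ₂.kerSubgroup ⊓ inertia vbar ≤ κ₁.kerSubgroup)
    (htor : ∀ m : M, ∃ k : ℕ, p ^ k • m = 0)
    (hstab : ∀ m : M, IsOpen (MulAction.stabilizer (absoluteGaloisGroup K) m : Set (absoluteGaloisGroup K)))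
    (hcont : ∀ m : M, Continuous fun g : absoluteGaloisGroup K ↦ g • m)
    [Finite (FixedPoints.addSubgroup (ZpExtension.pairKer κ₁ κ₂) M ⧸ (ResKernel.subOne (ZpExtension.pairKer κ₁ κ₂) M γ₁).range)]
    (D₂ : DualData₂ κ₁ κ₂ M vbar γ₁ γ₂) (D : DatumDualData κ₂ γ₂ M (Castella2018.AcSelmer.bdpData M p vbar) ∅) :
    letI : Module (IwasawaAlgebra p) (QuotSMulTop (PowerSeries.X : IwasawaAlgebra₂ p) D₂.X) :=
      Module.compHom _ (PowerSeries.C (R := IwasawaAlgebra p))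
    ∃ f : QuotSMulTop (PowerSeries.X : IwasawaAlgebra₂ p) D₂.X →ₗ[IwasawaAlgebra p] D.X,
      (∀ (x : D₂.X) (t : unrSelmer κ₂ M vbar ∅), D.toDual (f (Submodule.Quotient.mk x)) t =
        D₂.toDual x ⟨resOfLe M (ZpExtension.pairKer_le_right κ₁ κ₂) (t : subgroupH1 κ₂.kerSubgroup M),
          resOfLe_mem_datumSelmer p (Castella2018.AcSelmer.bdpData M p vbar) ∅ (ZpExtension.pairKer_le_right κ₁ κ₂) t.2⟩) ∧
      Function.Injective f ∧
      (Finite (D.X ⧸ LinearMap.range f) ∧ Nat.card (D.X ⧸ LinearMap.range f) ≤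
        Nat.card (FixedPoints.addSubgroup (ZpExtension.pairKer κ₁ κ₂) M ⧸ (ResKernel.subOne (ZpExtension.pairKer κ₁ κ₂) M γ₁).range)) := by
  letI inst : Module (IwasawaAlgebra p) (QuotSMulTop (PowerSeries.X : IwasawaAlgebra₂ p) D₂.X) :=
    Module.compHom _ (PowerSeries.C (R := IwasawaAlgebra p))
  set res := resOfLe M (ZpExtension.pairKer_le_right κ₁ κ₂) with hres
  -- the control map on the unramified group of the line
  let g : unrSelmer κ₂ M vbar ∅ →+ unrSelmer₂ κ₁ κ₂ M vbar :=
    ((res).restrict (unrSelmer κ₂ M vbar ∅)).codRestrict (unrSelmer₂ κ₁ κ₂ M vbar)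
      fun t ↦ resOfLe_mem_datumSelmer p (Castella2018.AcSelmer.bdpData M p vbar) ∅ (ZpExtension.pairKer_le_right κ₁ κ₂) t.2
  have hg : ∀ t, ((g t : unrSelmer₂ κ₁ κ₂ M vbar) : subgroupH1 (ZpExtension.pairKer κ₁ κ₂) M) = res (t : subgroupH1 κ₂.kerSubgroup M) :=
    fun _ ↦ rfl
  have hg₁ : ∀ t, conjSel₂ κ₁ κ₂ M vbar γ₁ (g t) = g t := fun t ↦ by
    apply Subtype.ext
    rw [coe_conjSel₂_apply, hg]
    exact conjH1_resOfLe_pairKer_right_of_mem hγ.2.1 _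
  have hg₂ : ∀ t, conjSel₂ κ₁ κ₂ M vbar γ₂ (g t) = g (conjUnr κ₂ M vbar ∅ γ₂ t) := fun t ↦ by
    apply Subtype.ext
    rw [coe_conjSel₂_apply, hg, hg]
    exact (resOfLe_conjH1_comm (ZpExtension.pairKer_le_right κ₁ κ₂) γ₂ _).symm
  -- the transpose along `constantCoeff`
  have hT := isLocNil_conjUnr_sub_one κ₂ vbar (∅ : Set (HeightOneSpectrum (𝓞 K))) htor hstab hγ.right
  have hTT : ∀ (y : D.X) (t : unrSelmer κ₂ M vbar ∅),
      D.toDual ((PowerSeries.X : IwasawaAlgebra p) • y) t = D.toDual y (conjUnr κ₂ M vbar ∅ γ₂ t) - D.toDual y t :=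
    fun y t ↦ D.toDual_T_smul y t
  obtain ⟨φ, hφ'⟩ := exists_semilinear_restrict_outer (conjSel₂ κ₁ κ₂ M vbar γ₁) (conjSel₂ κ₁ κ₂ M vbar γ₂) (conjUnr κ₂ M vbar ∅ γ₂) g
    D₂.toDual D.toDual hT D.bijective D₂.toDual_T₁_smul D₂.toDual_T₂_smul D₂.toDual_C_smul hTT D.toDual_C_smul hg₁ hg₂
  have hφ : ∀ (x : D₂.X) (t : unrSelmer κ₂ M vbar ∅), D.toDual (φ x) t = D₂.toDual x (g t) := fun x t ↦ by
    rw [hφ', AddMonoidHom.comp_apply]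
  -- `φ` kills `T₁ • ⊤`; descend
  have hX : ∀ x : D₂.X, φ ((PowerSeries.X : IwasawaAlgebra₂ p) • x) = 0 := fun x ↦ by
    rw [LinearMap.map_smulₛₗ, PowerSeries.constantCoeff_X, zero_smul]
  have hle : (PowerSeries.X : IwasawaAlgebra₂ p) • (⊤ : Submodule (IwasawaAlgebra₂ p) D₂.X) ≤ LinearMap.ker φ := by
    intro x hx
    obtain ⟨y, -, rfl⟩ := (Submodule.mem_smul_pointwise_iff_exists _ _ _).mp hx
    exact hX y
  let f₀ : QuotSMulTop (PowerSeries.X : IwasawaAlgebra₂ p) D₂.X →ₛₗ[PowerSeries.constantCoeff (R := IwasawaAlgebra p)] D.X :=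
    ((PowerSeries.X : IwasawaAlgebra₂ p) • (⊤ : Submodule (IwasawaAlgebra₂ p) D₂.X)).liftQ φ hle
  have hf₀ : ∀ x : D₂.X, f₀ (Submodule.Quotient.mk x) = φ x := fun x ↦ rfl
  let f : QuotSMulTop (PowerSeries.X : IwasawaAlgebra₂ p) D₂.X →ₗ[IwasawaAlgebra p] D.X :=
    { toFun := f₀
      map_add' := f₀.map_add
      map_smul' := fun a q ↦ by
        change f₀ ((PowerSeries.C a : IwasawaAlgebra₂ p) • q) = a • f₀ q
        rw [f₀.map_smulₛₗ, PowerSeries.constantCoeff_C] }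
  have hf : ∀ x : D₂.X, f (Submodule.Quotient.mk x) = φ x := hf₀
  refine ⟨f, fun x t ↦ by rw [hf, hφ]; rfl, ?_, ?_⟩
  · -- injective: exact control
    rw [injective_iff_map_eq_zero]
    intro q hq
    obtain ⟨x, rfl⟩ := Submodule.Quotient.mk_surjective _ q
    rw [hf] at hq
    -- `D₂.toDual x` kills the image of `g`, hence the `γ₁`-invariants (tower lift), hence `x ∈ T₁ D₂.X`
    have hkill : ∀ t : unrSelmer κ₂ M vbar ∅, D₂.toDual x (g t) = 0 := fun t ↦ by rw [← hφ, hq, map_zero, AddMonoidHom.zero_apply]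
    have hvan : ∀ s : unrSelmer₂ κ₁ κ₂ M vbar, (conjSel₂ κ₁ κ₂ M vbar γ₁ - 1) s = 0 → D₂.toDual x s = 0 := by
      intro s hs
      have hs' : conjSel₂ κ₁ κ₂ M vbar γ₁ s = s := by
        change conjSel₂ κ₁ κ₂ M vbar γ₁ s - s = 0 at hs
        rwa [sub_eq_zero] at hs
      obtain ⟨y, hyJ, hy⟩ := exists_mem_comap_resOfLe_eq hγ hcont htor s hs'
      rw [comap_resOfLe_unrSelmer₂_eq_unrSelmer_of_inf_inertia_le hI] at hyJ
      have hgt : g ⟨y, hyJ⟩ = s := Subtype.ext (by rw [hg]; exact hy)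
      rw [← hgt]
      exact hkill _
    obtain ⟨yb, hyb⟩ := IwasawaTwoVariable.exists_comp_eq_of_forall_ker _ _ hvan
    obtain ⟨y', hy'⟩ := D₂.bijective.2 yb
    have hx : x = (PowerSeries.X : IwasawaAlgebra₂ p) • y' := D₂.bijective.1 (by
      ext s
      rw [hyb, AddMonoidHom.comp_apply, IwasawaTwoVariable.toDual_T₁_smul_eq, hy']
      rfl)
    rw [hx]
    exact (Submodule.Quotient.mk_eq_zero _).mpr (Submodule.smul_mem_pointwise_smul y' _ ⊤ Submodule.mem_top)
  · -- cokernel: the image of `φ` is the annihilator of `ker g`, which embeds in `ker res` (finite)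
    have hrange : (LinearMap.range f).toAddSubgroup = φ.toAddMonoidHom.range := by
      ext y
      simp only [Submodule.mem_toAddSubgroup, LinearMap.mem_range, AddMonoidHom.mem_range, LinearMap.toAddMonoidHom_coe]
      constructor
      · rintro ⟨q, rfl⟩
        obtain ⟨x, rfl⟩ := Submodule.Quotient.mk_surjective _ q
        exact ⟨x, (hf x).symm⟩
      · rintro ⟨x, rfl⟩
        exact ⟨Submodule.Quotient.mk x, hf x⟩
    have hR : ∀ y : D.X, y ∈ φ.toAddMonoidHom.range ↔ ∀ t : unrSelmer κ₂ M vbar ∅, g t = 0 → D.toDual y t = 0 := by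
      intro y
      constructor
      · rintro ⟨x, rfl⟩ t ht
        rw [LinearMap.toAddMonoidHom_coe, hφ, ht, map_zero]
      · intro hy
        obtain ⟨ψ, hψ⟩ := IwasawaTwoVariable.exists_comp_eq_of_forall_ker_of_hom g (D.toDual y) hy
        obtain ⟨x, hx⟩ := D₂.bijective.2 ψ
        refine ⟨x, D.bijective.1 ?_⟩
        ext t
        rw [LinearMap.toAddMonoidHom_coe, hφ, hx, hψ, AddMonoidHom.comp_apply]
    -- `ker g ↪ ker res`, finite
    obtain ⟨hfinK, hcardK⟩ := finite_ker_resOfLe_pairKer_right_and_card_le (M := M) hγ hcont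
    let i : g.ker → (resOfLe M (ZpExtension.pairKer_le_right κ₁ κ₂)).ker := fun t ↦
      ⟨((t : unrSelmer κ₂ M vbar ∅) : subgroupH1 κ₂.kerSubgroup M), by
        have ht : g (t : unrSelmer κ₂ M vbar ∅) = 0 := (AddMonoidHom.mem_ker).mp t.2
        rw [AddMonoidHom.mem_ker, ← hres, ← hg, ht]
        rfl⟩
    have hi : Function.Injective i := fun s t hst ↦
      Subtype.ext (Subtype.ext (congrArg (fun x ↦ (x.1 : subgroupH1 κ₂.kerSubgroup M)) hst))
    haveI := hfinK
    haveI : Finite g.ker := Finite.of_injective i hi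
    obtain ⟨h1, h2⟩ := finite_quotient_and_card_le_of_annihilator D.toDual g φ.toAddMonoidHom.range hR
    let e : D.X ⧸ LinearMap.range f ≃+ D.X ⧸ φ.toAddMonoidHom.range := QuotientAddGroup.quotientAddEquivOfEq hrange
    exact ⟨Finite.of_equiv _ e.toEquiv.symm,
      ((Nat.card_congr e.toEquiv).trans_le h2).trans ((Nat.card_le_card_of_injective i hi).trans hcardK)⟩

end Line

/-! ## §3. Road α frames: THE `v̄`-line and ANY partner -/

section Frame

open Summit.BirchSwinnertonDyer.BirchSwinnertonDyer.Theorems.PrintCf2.AdditiveAtSeven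
open Summit.BirchSwinnertonDyer.BirchSwinnertonDyer.Theorems.PrintCf2.SplitPrimeLine

variable {K : Type} [Field K] [NumberField K]

/-- **`ker κ₂ ⊓ I_v̄ ≤ ker κ₁` for THE `v̄`-line `κ₂` and ANY partner `κ₁`** (`K` imaginary quadratic, `p = v v̄` split, ANY `p`, `(κ₁, κ₂; γ₁, γ₂)` a
generator pair with `κ₂` unramified outside `v̄`): the tree's inertia group `GreenbergSelmer.inertia v̄` is `I_{𝔓₀}` for the prime `𝔓₀ = adicCompletionPrime K v̄`
above `v̄` (`inertia_adicCompletionPrime_eq_map_absInertia`, Neukirch II (9.6)), and `I_{𝔓₀} ⊓ ker κ₂ ≤ pairKer κ₁ κ₂ ≤ ker κ₁` because inertia above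
`v̄` is RANK ONE in the `ℤ_p²`-tower and `κ₂` is ramified at `𝔓₀` (-w5 g4 p680726 `SplitPrimeLine.inertia_inf_kerSubgroup_le_pairKer_of_isUnramifiedOutside`):
`K̃_∞ / K_∞^{(2)}` is unramified above `v̄`. [cite: GreenbergLNM1716, §1 p. 53] [cite: Agboola2007, §1 p. 1, §4] [cite: NeukirchANT1999, Ch. II §9 (9.6)] -/
theorem kerSubgroup_inf_inertia_le_of_isUnramifiedOutside_of_pair {p : ℕ} [Fact p.Prime] (hK : IsImaginaryQuadratic K)
    {v vbar : HeightOneSpectrum (𝓞 K)} (hv : ((p : ℕ) : 𝓞 K) ∈ v.asIdeal) (hvbar : ((p : ℕ) : 𝓞 K) ∈ vbar.asIdeal) (hne : vbar ≠ v)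
    {κ₁ κ₂ : ZpExtension K p} {γ₁ γ₂ : absoluteGaloisGroup K} (hγ : ZpExtension.IsTopGeneratorPair κ₁ κ₂ γ₁ γ₂)
    (hκ₂ : κ₂.IsUnramifiedOutside vbar) :
    κ₂.kerSubgroup ⊓ inertia vbar ≤ κ₁.kerSubgroup := by
  intro x hx
  have hxI : x ∈ (adicCompletionPrime K vbar).inertia (absoluteGaloisGroup K) := by
    rw [inertia_adicCompletionPrime_eq_map_absInertia]
    exact hx.2
  have hpair : x ∈ ZpExtension.pairKer κ₁ κ₂ :=
    inertia_inf_kerSubgroup_le_pairKer_of_isUnramifiedOutside hK hv hvbar hne hγ hκ₂ (adicCompletionPrime_mem_primesAbove K vbar)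
      (Subgroup.mem_inf.mpr ⟨hxI, hx.1⟩)
  exact (Subgroup.mem_inf.mp hpair).1

/-- **`W*(K̃_∞)` is finite on every frame for ANY two `ℤ₂`-lines** (member `C • W = cm7^{(d)}`, `K` imaginary quadratic, ANY `π, r`, ANY
`κ₁ κ₂ : ZpExtension K 2`): the place of `K` above `7` is ADDITIVE for `W_K` (`j = −3375`, `…SplitBadTwoAdditiveAtSeven`), prime to `2`, hence
unramified in every `ℤ₂`-extension (§1). p683924/p685748's `finite_fixedPoints_pairKer_of_frame(_right)` with the `IsUnramifiedOutside` hypotheses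
(and the places `v`, `v̄`) DELETED. [cite: Agboola2007, §3 Prop. 3.2] [cite: SilvermanATAEC1994, Thm. IV.10.2(a)] [cite: Washington1997, Prop. 13.2] -/
theorem finite_fixedPoints_pairKer_of_frame_any {d : ℤ} (hd0 : d ≠ 0) (W : WeierstrassCurve ℚ) [W.IsElliptic]
    (C : VariableChange ℚ) (hC : C • W = cm7.quadraticTwist (d : ℚ)) (hK : IsImaginaryQuadratic K)
    (π : (W.baseChange K).endRing) (r : ℤ_[2]) (κ₁ κ₂ : ZpExtension K 2) :
    Finite (FixedPoints.addSubgroup (ZpExtension.pairKer κ₁ κ₂) ↥((W.baseChange K).endEigenPrimaryTorsion 2 π r)) := by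
  obtain ⟨w, h7⟩ := exists_heightOneSpectrum_natCast_mem (K := K) (q := 7) (by norm_num)
  have h2w : ((2 : ℕ) : 𝓞 K) ∉ w.asIdeal := natCast_two_notMem_of_seven_mem w h7
  haveI : (W.baseChange K).IsElliptic := by rw [baseChange]; infer_instance
  exact finite_fixedPoints_pairKer_endEigenPrimaryTorsion_of_hasAdditiveReductionAt_of_not_mem (W.baseChange K) π r κ₁ κ₂ h2w
    (hasAdditiveReductionAt_baseChange_of_j_eq_cm7_of_finrank_eq_two K w hK.1 W (j_eq_of_smul_eq_cm7Twist hd0 W C hC) h7)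

/-- **(RES) FOR THE UNRAMIFIED DATUM ON EVERY FRAME, ANY PARTNER `κ₁`, NO DISPLAYED HYPOTHESIS ON `κ₁`.** Member `C • W = cm7^{(d)}`, `K` imaginary
quadratic, `v ≠ v̄` over `2`, ANY `π, r` (`W* = ↥((W.baseChange K).endEigenPrimaryTorsion 2 π r)`), a generator pair `(κ₁, κ₂; γ₁, γ₂)` whose LINE `κ₂` is
unramified outside `v̄` — NOTHING asked of `κ₁` (the frame block of the LEAD's S3b′-v12 `stub_restrictedMainConj_two_v12` verbatim) — ANY
`D₂ : DualData₂ κ₁ κ₂ W* v̄ γ₁ γ₂` and ANY `D_nr : DatumDualData κ₂ γ₂ W* (bdpData W* 2 v̄) ∅`: `QuotSMulTop T₁ D₂.X` and `D_nr.X` are PSEUDO-ISOMORPHIC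
`Λ`-modules (`Λ` through `PowerSeries.C`) and **`ch_Λ(D₂.X ⧸ T₁ D₂.X) = ch_Λ(D_nr.X)`**. p685748's `charIdeal_quotSMulTop_eq_unr_of_frame` with
`hκ₁ : κ₁.IsUnramifiedOutside v` DELETED (§2 + `kerSubgroup_inf_inertia_le_of_isUnramifiedOutside_of_pair` + `finite_fixedPoints_pairKer_of_frame_any`).
[cite: GreenbergVatsal2000, §2 pp. 17–21] [cite: Agboola2007, §4] [cite: SkinnerUrban2014, Cor. 3.2.9 (ii)] [cite: GreenbergLNM1716, §1 p. 53] -/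
theorem charIdeal_quotSMulTop_eq_unr_of_frame_anyPartner {d : ℤ} (hd0 : d ≠ 0) (W : WeierstrassCurve ℚ) [W.IsElliptic]
    (C : VariableChange ℚ) (hC : C • W = cm7.quadraticTwist (d : ℚ)) (hK : IsImaginaryQuadratic K)
    (v vbar : HeightOneSpectrum (𝓞 K)) (hv : ((2 : ℕ) : 𝓞 K) ∈ v.asIdeal) (hvbar : ((2 : ℕ) : 𝓞 K) ∈ vbar.asIdeal) (hne : vbar ≠ v)
    (π : (W.baseChange K).endRing) (r : ℤ_[2]) (κ₁ κ₂ : ZpExtension K 2)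
    (hκ₂ : κ₂.IsUnramifiedOutside vbar) {γ₁ γ₂ : absoluteGaloisGroup K} (hγ : ZpExtension.IsTopGeneratorPair κ₁ κ₂ γ₁ γ₂)
    (D₂ : DualData₂ κ₁ κ₂ ↥((W.baseChange K).endEigenPrimaryTorsion 2 π r) vbar γ₁ γ₂)
    (D : DatumDualData κ₂ γ₂ ↥((W.baseChange K).endEigenPrimaryTorsion 2 π r)
      (Castella2018.AcSelmer.bdpData ↥((W.baseChange K).endEigenPrimaryTorsion 2 π r) 2 vbar) ∅) :
    letI : Module (IwasawaAlgebra 2) (QuotSMulTop (PowerSeries.X : IwasawaAlgebra₂ 2) D₂.X) :=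
      Module.compHom _ (PowerSeries.C (R := IwasawaAlgebra 2))
    Module.ArePseudoIsomorphic (IwasawaAlgebra 2) (QuotSMulTop (PowerSeries.X : IwasawaAlgebra₂ 2) D₂.X) D.X ∧
      Module.charIdeal (IwasawaAlgebra 2) (QuotSMulTop (PowerSeries.X : IwasawaAlgebra₂ 2) D₂.X) =
        Module.charIdeal (IwasawaAlgebra 2) D.X := by
  letI inst : Module (IwasawaAlgebra 2) (QuotSMulTop (PowerSeries.X : IwasawaAlgebra₂ 2) D₂.X) :=
    Module.compHom _ (PowerSeries.C (R := IwasawaAlgebra 2))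
  have htor : ∀ m : ↥((W.baseChange K).endEigenPrimaryTorsion 2 π r), ∃ k : ℕ, 2 ^ k • m = 0 :=
    exists_pow_smul_endEigenPrimaryTorsion_eq_zero (W.baseChange K) 2 π r
  have hstab : ∀ m : ↥((W.baseChange K).endEigenPrimaryTorsion 2 π r),
      IsOpen (MulAction.stabilizer (absoluteGaloisGroup K) m : Set (absoluteGaloisGroup K)) :=
    isOpen_stabilizer_endEigenPrimaryTorsion (W.baseChange K) 2 π r
  have hcont : ∀ m : ↥((W.baseChange K).endEigenPrimaryTorsion 2 π r), Continuous fun σ : absoluteGaloisGroup K ↦ σ • m :=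
    continuous_smul_endEigenPrimaryTorsion (W.baseChange K) 2 π r
  have hI : κ₂.kerSubgroup ⊓ inertia vbar ≤ κ₁.kerSubgroup :=
    kerSubgroup_inf_inertia_le_of_isUnramifiedOutside_of_pair hK hv hvbar hne hγ hκ₂
  haveI hF : Finite (FixedPoints.addSubgroup (ZpExtension.pairKer κ₁ κ₂) ↥((W.baseChange K).endEigenPrimaryTorsion 2 π r)) :=
    finite_fixedPoints_pairKer_of_frame_any hd0 W C hC hK π r κ₁ κ₂
  haveI : Finite (FixedPoints.addSubgroup (ZpExtension.pairKer κ₁ κ₂) ↥((W.baseChange K).endEigenPrimaryTorsion 2 π r) ⧸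
      (ResKernel.subOne (ZpExtension.pairKer κ₁ κ₂) ↥((W.baseChange K).endEigenPrimaryTorsion 2 π r) γ₁).range) := inferInstance
  refine (exists_linearMap_quotSMulTop_unr_of_inf_inertia_le hγ hI htor hstab hcont D₂ D).elim fun f hf ↦ ?_
  have hker : Module.IsPseudoNull (IwasawaAlgebra 2) (LinearMap.ker f) := by
    haveI : Finite (LinearMap.ker f) := by
      rw [LinearMap.ker_eq_bot.mpr hf.2.1]
      infer_instance
    exact isPseudoNull_of_finite 2 _
  haveI := hf.2.2.1
  have hpi : Module.ArePseudoIsomorphic (IwasawaAlgebra 2) (QuotSMulTop (PowerSeries.X : IwasawaAlgebra₂ 2) D₂.X) D.X :=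
    ⟨f, hker, isPseudoNull_of_finite 2 _⟩
  exact ⟨hpi, Module.charIdeal_eq_of_arePseudoIsomorphic hpi⟩

end Frame

end Summit.BirchSwinnertonDyer.BirchSwinnertonDyer.Theorems.PrintCf2.LinePush
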